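import Mathlib
import Summits.Ventures.HodgeRepro.Tier4.Line4.LocSizeCutoff
import Summits.Ventures.HodgeRepro.Tier4.Line4.D3CoeffGeneral
import Summits.Ventures.HodgeRepro.Tier4.Line4.ArchProdCoeff
import Summits.Ventures.HodgeRepro.Tier4.Line4.ArchProdInfOnly
import Summits.Ventures.HodgeRepro.Tier4.Line4.ArchFactorProd

/-!
# Tier4/Line4/ArchProdCutoff — the GENERIC product of place-factors over `w′ ≠ w₀` (`placeProd`: continuity, `infOnly`, the
`equiv` law, the right `T′(𝔸)`-law, the bound, the support law) and the CUTOFF place-factor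
`cutFactor R w′ := defCoeff w′ (eP′ w′) (eM′ w′) · cutoff w′ R` with every law of `defCoeff` transferred and the uniform
bound `‖cutFactor‖ ≤ (R + 1)^{|eP′ w′| + |eM′ w′|}` — the pieces of the `hdef`-free witness (`ArchWitnessCutoff`)

Blind re-derivation cell `pub-hodge-repro`, Tier 4 (README §9–§10), seat t4-L1-p5 (prover, gen 5; C-L4-7A-NODEF S15560,
plan-4's GO S15565; module 2 of 4).  Target tree path `lean/Summits/Ventures/HodgeRepro/Tier4/Line4/ArchProdCutoff.lean`.
On the seat's `LocSizeCutoff` (p709514: `cutoff`, `locSize_lt_of_cutoff_ne_zero`, `archSizeAt_le_locSize`), `DefiniteCoeff`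
(p703816), `D3CoeffGeneral` (p704822: `d3Gen`, `d3Gen'`), `ArchProdCoeff` (p705212), `ArchProdInfOnly` (p705506),
`ArchFactorProd` (p706229: `torusWeight'`, `d3Gen(')_mul_torus'`), `D3CoeffDecayConj` (p701824: `hasDecay3_of_bump`);
no printed input.

THE MECHANISM.  A GENERIC product over the places `w′ ≠ w₀` of a family `F w′` of place-factors (`placeProd`): continuity,
`infOnly`, the `equiv` law at a place `w ≠ w₀` from the `w`-factor's law and the other factors' invariance, the triviality
under `T′_{w₀}`, the right `T′(𝔸)`-law, the product bound, and the support law (`placeProd x ≠ 0 → every factor ≠ 0`).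
The family of record **`cutFactor R w′ := defCoeff w′ (eP′ w′) (eM′ w′) · cutoff w′ R`**: the cutoff is bi-invariant, so every
law of `defCoeff` (p703816) transfers verbatim, and on the support `locSize w′ < R + 1`, hence `‖defCoeff w′ x‖ ≤ (R + 1)^{n_{w′}}`
(`n_{w′} = |eP′ w′| + |eM′ w′|`, the total degree of the monomials) and `archSizeAt w′ x ≤ locSizeBound w′ · (R + 1)` — exactly the
`hB` / `hsupp` of `hasDecay3_of_bump`, at EVERY real CM place, definite or indefinite, either orientation.

WHAT IS PROVED (kernel, no print): `placeProd` + `continuous_placeProd`, `placeProd_ofInfPart`, `placeProd_mul_of_base`,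
`cj_placeProd_inv_mul`, `placeProd_mul_torus'`, `norm_placeProd_le`, `ne_zero_of_placeProd_ne_zero`; `norm_wtMono`,
`norm_defCoeff_le_pow`; `cutFactor` with its laws (`continuous_cutFactor`, `cutFactor_ofInfPart`, `cj_cutFactor_inv_mul`,
`cutFactor_mul_of_mem_localTorusAt'_ne`, `cutFactor_mul_torus'`, `norm_cutFactor_le`, `locSize_lt_of_cutFactor_ne_zero`);
the witness `archWitnessR(')` itself, its `equiv`/right laws and its `decay` are `ArchWitnessCutoff` (module 3).  Nothing here says anything about the status of the Hodge conjecture for CM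
abelian varieties, which is NOT proved (HC_CM is NOT proved by anyone in this repository).
-/

set_option autoImplicit false

noncomputable section

namespace Summit.Ventures.HodgeRepro.Tier4.Line4

open Summit.Ventures.HodgeRepro.Tier4.Common Summit.Ventures.HodgeRepro.Tier4.Line1 NumberField Matrix

open scoped ComplexConjugate

open scoped Classical

section Generic

variable {k : Type} [Field k] [NumberField k] (q : QuadData k) (a : Fin 4 → k)
  (g g' : Matrix (Fin 4) (Fin 4) k) (hgg' : g * g' = 1) (hg'g : g' * g = 1)
  (hgΩ : g * (PlaneData.mixedRow q (a 0) (a 2)).Ω = (PlaneData.mixedRow q (a 0) (a 2)).Ω * g)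
  (w₀ : InfinitePlace k) (eP' eM' : InfinitePlace k → ℤ)

/-- **the product over the places `w′ ≠ w₀` of a family of place-factors.** -/
def placeProd (F : InfinitePlace k → GA ((PlaneData.mixedRow q (a 0) (a 2)).withTransportedTorus g g' hgg' hg'g hgΩ) → ℂ)
    (x : GA ((PlaneData.mixedRow q (a 0) (a 2)).withTransportedTorus g g' hgg' hg'g hgΩ)) : ℂ :=
  ∏ w' ∈ Finset.univ.erase w₀, F w' x

variable (F : InfinitePlace k → GA ((PlaneData.mixedRow q (a 0) (a 2)).withTransportedTorus g g' hgg' hg'g hgΩ) → ℂ)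

/-- continuity of the product. -/
theorem continuous_placeProd (hF : ∀ w', Continuous (F w')) : Continuous (placeProd q a g g' hgg' hg'g hgΩ w₀ F) :=
  continuous_finsetProd _ fun w' _ => hF w'

/-- `infOnly` of the product. -/
theorem placeProd_ofInfPart (hF : ∀ w' x, F w' x = F w' (GA.ofInfPart _ x))
    (x : GA ((PlaneData.mixedRow q (a 0) (a 2)).withTransportedTorus g g' hgg' hg'g hgΩ)) :
    placeProd q a g g' hgg' hg'g hgΩ w₀ F x = placeProd q a g g' hgg' hg'g hgΩ w₀ F (GA.ofInfPart _ x) :=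
  Finset.prod_congr rfl fun w' _ => hF w' x

/-- `T′_{w₀}` acts trivially when every factor is untouched by `T′_{w₀}`. -/
theorem placeProd_mul_of_base
    (htriv : ∀ w', w' ≠ w₀ → ∀ κ : GA ((PlaneData.mixedRow q (a 0) (a 2)).withTransportedTorus g g' hgg' hg'g hgΩ),
      κ ∈ localTorusAt' ((PlaneData.mixedRow q (a 0) (a 2)).withTransportedTorus g g' hgg' hg'g hgΩ) w₀ → ∀ x,
      F w' (κ * x) = F w' x)
    {κ : GA ((PlaneData.mixedRow q (a 0) (a 2)).withTransportedTorus g g' hgg' hg'g hgΩ)}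
    (hκ : κ ∈ localTorusAt' ((PlaneData.mixedRow q (a 0) (a 2)).withTransportedTorus g g' hgg' hg'g hgΩ) w₀)
    (x : GA ((PlaneData.mixedRow q (a 0) (a 2)).withTransportedTorus g g' hgg' hg'g hgΩ)) :
    placeProd q a g g' hgg' hg'g hgΩ w₀ F (κ * x) = placeProd q a g g' hgg' hg'g hgΩ w₀ F x :=
  Finset.prod_congr rfl fun w' hw' => htriv w' (Finset.ne_of_mem_erase hw') κ hκ x

/-- **the `equiv` law of the product at a place `w ≠ w₀`** from the `w`-factor's law and the other factors' invariance. -/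
theorem cj_placeProd_inv_mul
    (hlaw : ∀ w', w' ≠ w₀ → ∀ κ : GA ((PlaneData.mixedRow q (a 0) (a 2)).withTransportedTorus g g' hgg' hg'g hgΩ),
      κ ∈ localTorusAt' ((PlaneData.mixedRow q (a 0) (a 2)).withTransportedTorus g g' hgg' hg'g hgΩ) w' → ∀ y,
      RTF.cj (F w') (κ⁻¹ * y) =
        weightAt' ((PlaneData.mixedRow q (a 0) (a 2)).withTransportedTorus g g' hgg' hg'g hgΩ) q w' g g' 0 κ ^ (-eP' w') *
          weightAt' ((PlaneData.mixedRow q (a 0) (a 2)).withTransportedTorus g g' hgg' hg'g hgΩ) q w' g g' 1 κ ^ (-eM' w') *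
          RTF.cj (F w') y)
    (htriv : ∀ w', w' ≠ w₀ → ∀ w, w ≠ w' →
      ∀ κ : GA ((PlaneData.mixedRow q (a 0) (a 2)).withTransportedTorus g g' hgg' hg'g hgΩ),
      κ ∈ localTorusAt' ((PlaneData.mixedRow q (a 0) (a 2)).withTransportedTorus g g' hgg' hg'g hgΩ) w → ∀ x,
      F w' (κ * x) = F w' x)
    {w : InfinitePlace k} (hw : w ≠ w₀)
    {κ : GA ((PlaneData.mixedRow q (a 0) (a 2)).withTransportedTorus g g' hgg' hg'g hgΩ)}
    (hκ : κ ∈ localTorusAt' ((PlaneData.mixedRow q (a 0) (a 2)).withTransportedTorus g g' hgg' hg'g hgΩ) w)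
    (y : GA ((PlaneData.mixedRow q (a 0) (a 2)).withTransportedTorus g g' hgg' hg'g hgΩ)) :
    RTF.cj (placeProd q a g g' hgg' hg'g hgΩ w₀ F) (κ⁻¹ * y) =
      weightAt' ((PlaneData.mixedRow q (a 0) (a 2)).withTransportedTorus g g' hgg' hg'g hgΩ) q w g g' 0 κ ^ (-eP' w) *
        weightAt' ((PlaneData.mixedRow q (a 0) (a 2)).withTransportedTorus g g' hgg' hg'g hgΩ) q w g g' 1 κ ^ (-eM' w) *
        RTF.cj (placeProd q a g g' hgg' hg'g hgΩ w₀ F) y := by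
  have hκ' : κ⁻¹ ∈ localTorusAt' ((PlaneData.mixedRow q (a 0) (a 2)).withTransportedTorus g g' hgg' hg'g hgΩ) w :=
    (localTorusAt' _ w).inv_mem hκ
  have hws : w ∈ (Finset.univ : Finset (InfinitePlace k)).erase w₀ := Finset.mem_erase.2 ⟨hw, Finset.mem_univ w⟩
  have hsplit : ∀ z, ∏ w' ∈ (Finset.univ : Finset (InfinitePlace k)).erase w₀, F w' z =
      F w z * ∏ w' ∈ ((Finset.univ : Finset (InfinitePlace k)).erase w₀).erase w, F w' z :=
    fun z => (Finset.mul_prod_erase _ (fun w' => F w' z) hws).symm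
  have htriv' : ∏ w' ∈ ((Finset.univ : Finset (InfinitePlace k)).erase w₀).erase w, F w' (κ⁻¹ * y) =
      ∏ w' ∈ ((Finset.univ : Finset (InfinitePlace k)).erase w₀).erase w, F w' y :=
    Finset.prod_congr rfl fun w' hw' =>
      htriv w' (Finset.ne_of_mem_erase (Finset.mem_of_mem_erase hw')) w (Finset.ne_of_mem_erase hw').symm κ⁻¹ hκ' y
  have h := hlaw w hw κ hκ y
  simp only [RTF.cj] at h ⊢
  unfold placeProd
  rw [hsplit, hsplit y, htriv', map_mul, map_mul, h]
  ring

/-- **the right `T′(𝔸)`-law of the product** from the factors' right laws. -/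
theorem placeProd_mul_torus'
    (hlaw : ∀ w', w' ≠ w₀ → ∀ x κ : GA ((PlaneData.mixedRow q (a 0) (a 2)).withTransportedTorus g g' hgg' hg'g hgΩ),
      κ ∈ torusT' ((PlaneData.mixedRow q (a 0) (a 2)).withTransportedTorus g g' hgg' hg'g hgΩ) →
      F w' (x * κ) =
        weightAt' ((PlaneData.mixedRow q (a 0) (a 2)).withTransportedTorus g g' hgg' hg'g hgΩ) q w' g g' 0 κ ^ (-eP' w') *
          weightAt' ((PlaneData.mixedRow q (a 0) (a 2)).withTransportedTorus g g' hgg' hg'g hgΩ) q w' g g' 1 κ ^ (-eM' w') *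
          F w' x)
    (x κ : GA ((PlaneData.mixedRow q (a 0) (a 2)).withTransportedTorus g g' hgg' hg'g hgΩ))
    (hκ : κ ∈ torusT' ((PlaneData.mixedRow q (a 0) (a 2)).withTransportedTorus g g' hgg' hg'g hgΩ)) :
    placeProd q a g g' hgg' hg'g hgΩ w₀ F (x * κ) =
      (∏ w' ∈ Finset.univ.erase w₀,
        (weightAt' ((PlaneData.mixedRow q (a 0) (a 2)).withTransportedTorus g g' hgg' hg'g hgΩ) q w' g g' 0 κ ^ (-eP' w') *
          weightAt' ((PlaneData.mixedRow q (a 0) (a 2)).withTransportedTorus g g' hgg' hg'g hgΩ) q w' g g' 1 κ ^ (-eM' w'))) *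
        placeProd q a g g' hgg' hg'g hgΩ w₀ F x := by
  unfold placeProd
  rw [← Finset.prod_mul_distrib]
  exact Finset.prod_congr rfl fun w' hw' => hlaw w' (Finset.ne_of_mem_erase hw') x κ hκ

/-- the product bound. -/
theorem norm_placeProd_le (B : InfinitePlace k → ℝ)
    (hB : ∀ w', w' ≠ w₀ → ∀ x, ‖F w' x‖ ≤ B w')
    (x : GA ((PlaneData.mixedRow q (a 0) (a 2)).withTransportedTorus g g' hgg' hg'g hgΩ)) :
    ‖placeProd q a g g' hgg' hg'g hgΩ w₀ F x‖ ≤ ∏ w' ∈ Finset.univ.erase w₀, B w' := by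
  unfold placeProd
  rw [norm_prod]
  exact Finset.prod_le_prod (fun _ _ => norm_nonneg _) fun w' hw' => hB w' (Finset.ne_of_mem_erase hw') x

/-- the support law: a non-vanishing product has every factor non-zero. -/
theorem ne_zero_of_placeProd_ne_zero
    {x : GA ((PlaneData.mixedRow q (a 0) (a 2)).withTransportedTorus g g' hgg' hg'g hgΩ)}
    (h : placeProd q a g g' hgg' hg'g hgΩ w₀ F x ≠ 0) {w' : InfinitePlace k} (hw' : w' ≠ w₀) : F w' x ≠ 0 :=
  Finset.prod_ne_zero_iff.1 h w' (Finset.mem_erase.2 ⟨hw', Finset.mem_univ w'⟩)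

end Generic

section Factor

variable {k : Type} [Field k] [NumberField k] (q : QuadData k) (a : Fin 4 → k)
  (g g' : Matrix (Fin 4) (Fin 4) k) (hgg' : g * g' = 1) (hg'g : g' * g = 1)
  (hgΩ : g * (PlaneData.mixedRow q (a 0) (a 2)).Ω = (PlaneData.mixedRow q (a 0) (a 2)).Ω * g)
  (lam : k) (hlam : lam ≠ 0)
  (hiso : g * (PlaneData.mixedRow q (a 1) (a 3)).B * gᵀ = lam • (PlaneData.mixedRow q (a 0) (a 2)).B)
  (eP' eM' : InfinitePlace k → ℤ) (R : ℝ)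

/-- `‖wtMono p z‖ = ‖z‖ ^ (p₊ + p₋)`. -/
theorem norm_wtMono (p : ℤ) (z : ℂ) : ‖wtMono p z‖ = ‖z‖ ^ (p.toNat + (-p).toNat) := by
  unfold wtMono
  rw [norm_mul, norm_pow, norm_pow, Complex.norm_conj, pow_add]

/-- the total degree of the `(p, m)`-coefficient: `|p| + |m|` as `p₊ + p₋ + m₊ + m₋`. -/
def coeffDegree (p m : ℤ) : ℕ := p.toNat + (-p).toNat + (m.toNat + (-m).toNat)

/-- **`‖defCoeff w p m x‖ ≤ S ^ coeffDegree p m`** whenever the diagonal entries are bounded by `S ≥ 0`. -/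
theorem norm_defCoeff_le_pow (w : InfinitePlace k) (p m : ℤ) {S : ℝ} (hS : 0 ≤ S)
    (x : GA ((PlaneData.mixedRow q (a 0) (a 2)).withTransportedTorus g g' hgg' hg'g hgΩ))
    (h00 : ‖locEntry' q a g g' hgg' hg'g hgΩ lam hiso w x 0 0‖ ≤ S)
    (h11 : ‖locEntry' q a g g' hgg' hg'g hgΩ lam hiso w x 1 1‖ ≤ S) :
    ‖defCoeff q a g g' hgg' hg'g hgΩ lam hiso w p m x‖ ≤ S ^ coeffDegree p m := by
  unfold defCoeff coeffDegree
  rw [norm_mul, norm_wtMono, norm_wtMono, pow_add S]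
  exact mul_le_mul (pow_le_pow_left₀ (norm_nonneg _) h00 _) (pow_le_pow_left₀ (norm_nonneg _) h11 _)
    (by positivity) (by positivity)

/-- **the cutoff place-factor** `defCoeff w′ (eP′ w′) (eM′ w′) · cutoff w′ R`. -/
def cutFactor (w' : InfinitePlace k)
    (x : GA ((PlaneData.mixedRow q (a 0) (a 2)).withTransportedTorus g g' hgg' hg'g hgΩ)) : ℂ :=
  defCoeff q a g g' hgg' hg'g hgΩ lam hiso w' (eP' w') (eM' w') x * cutoff q a g g' hgg' hg'g hgΩ lam hiso w' R x

/-- continuity. -/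
theorem continuous_cutFactor (w' : InfinitePlace k) :
    Continuous (cutFactor q a g g' hgg' hg'g hgΩ lam hiso eP' eM' R w') :=
  (continuous_defCoeff q a g g' hgg' hg'g hgΩ lam hiso w' _ _).mul
    (continuous_cutoff q a g g' hgg' hg'g hgΩ lam hiso w' R)

/-- `infOnly`. -/
theorem cutFactor_ofInfPart (w' : InfinitePlace k)
    (x : GA ((PlaneData.mixedRow q (a 0) (a 2)).withTransportedTorus g g' hgg' hg'g hgΩ)) :
    cutFactor q a g g' hgg' hg'g hgΩ lam hiso eP' eM' R w' x =
      cutFactor q a g g' hgg' hg'g hgΩ lam hiso eP' eM' R w' (GA.ofInfPart _ x) := by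
  unfold cutFactor
  rw [← defCoeff_ofInfPart, ← cutoff_ofInfPart]

include hlam in
/-- the `equiv` law at the factor's own place. -/
theorem cj_cutFactor_inv_mul (w' : InfinitePlace k) (hw : w'.IsReal) (hcm : IsCMAt q w') (ha1 : a 1 ≠ 0) (ha3 : a 3 ≠ 0)
    {κ : GA ((PlaneData.mixedRow q (a 0) (a 2)).withTransportedTorus g g' hgg' hg'g hgΩ)}
    (hκ : κ ∈ localTorusAt' ((PlaneData.mixedRow q (a 0) (a 2)).withTransportedTorus g g' hgg' hg'g hgΩ) w')
    (y : GA ((PlaneData.mixedRow q (a 0) (a 2)).withTransportedTorus g g' hgg' hg'g hgΩ)) :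
    RTF.cj (cutFactor q a g g' hgg' hg'g hgΩ lam hiso eP' eM' R w') (κ⁻¹ * y) =
      weightAt' ((PlaneData.mixedRow q (a 0) (a 2)).withTransportedTorus g g' hgg' hg'g hgΩ) q w' g g' 0 κ ^ (-eP' w') *
        weightAt' ((PlaneData.mixedRow q (a 0) (a 2)).withTransportedTorus g g' hgg' hg'g hgΩ) q w' g g' 1 κ ^ (-eM' w') *
        RTF.cj (cutFactor q a g g' hgg' hg'g hgΩ lam hiso eP' eM' R w') y := by
  have hκT' : κ⁻¹ ∈ torusT' ((PlaneData.mixedRow q (a 0) (a 2)).withTransportedTorus g g' hgg' hg'g hgΩ) :=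
    (torusT' _).inv_mem hκ.1
  have h := cj_defCoeff_inv_mul q a g g' hgg' hg'g hgΩ lam hlam hiso w' hw hcm ha1 ha3 (eP' w') (eM' w') hκ y
  simp only [RTF.cj] at h ⊢
  unfold cutFactor
  rw [cutoff_torus'_mul q a g g' hgg' hg'g hgΩ lam hlam hiso w' R hw hcm ha1 ha3 y κ⁻¹ hκT', map_mul, map_mul, h]
  ring

include hlam in
/-- the other places' tori act trivially on `cutFactor w′`. -/
theorem cutFactor_mul_of_mem_localTorusAt'_ne (w' : InfinitePlace k) (hw : w'.IsReal) (hcm : IsCMAt q w')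
    {w : InfinitePlace k} (hne : w ≠ w')
    {κ : GA ((PlaneData.mixedRow q (a 0) (a 2)).withTransportedTorus g g' hgg' hg'g hgΩ)}
    (hκ : κ ∈ localTorusAt' ((PlaneData.mixedRow q (a 0) (a 2)).withTransportedTorus g g' hgg' hg'g hgΩ) w)
    (x : GA ((PlaneData.mixedRow q (a 0) (a 2)).withTransportedTorus g g' hgg' hg'g hgΩ)) :
    cutFactor q a g g' hgg' hg'g hgΩ lam hiso eP' eM' R w' (κ * x) =
      cutFactor q a g g' hgg' hg'g hgΩ lam hiso eP' eM' R w' x := by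
  unfold cutFactor
  rw [defCoeff_mul_of_mem_localTorusAt'_ne q a g g' hgg' hg'g hgΩ lam hlam hiso w' hw hcm hne _ _ hκ x,
    cutoff_mul_of_mem_localTorusAt'_ne q a g g' hgg' hg'g hgΩ lam hlam hiso w' R hw hcm hne hκ x]

include hlam in
/-- the right `T′(𝔸)`-law of `cutFactor w′`. -/
theorem cutFactor_mul_torus' (w' : InfinitePlace k) (hw : w'.IsReal) (hcm : IsCMAt q w') (ha1 : a 1 ≠ 0) (ha3 : a 3 ≠ 0)
    (x κ : GA ((PlaneData.mixedRow q (a 0) (a 2)).withTransportedTorus g g' hgg' hg'g hgΩ))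
    (hκ : κ ∈ torusT' ((PlaneData.mixedRow q (a 0) (a 2)).withTransportedTorus g g' hgg' hg'g hgΩ)) :
    cutFactor q a g g' hgg' hg'g hgΩ lam hiso eP' eM' R w' (x * κ) =
      weightAt' ((PlaneData.mixedRow q (a 0) (a 2)).withTransportedTorus g g' hgg' hg'g hgΩ) q w' g g' 0 κ ^ (-eP' w') *
        weightAt' ((PlaneData.mixedRow q (a 0) (a 2)).withTransportedTorus g g' hgg' hg'g hgΩ) q w' g g' 1 κ ^ (-eM' w') *
        cutFactor q a g g' hgg' hg'g hgΩ lam hiso eP' eM' R w' x := by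
  unfold cutFactor
  rw [defCoeff_mul_torus' q a g g' hgg' hg'g hgΩ lam hlam hiso w' hw hcm ha1 ha3 _ _ x κ hκ,
    cutoff_mul_torus' q a g g' hgg' hg'g hgΩ lam hlam hiso w' R hw hcm ha1 ha3 x κ hκ]
  ring

/-- **the uniform bound** `‖cutFactor w′ x‖ ≤ (R + 1) ^ coeffDegree (eP′ w′) (eM′ w′)` for `0 ≤ R`. -/
theorem norm_cutFactor_le (hR : 0 ≤ R) (w' : InfinitePlace k)
    (x : GA ((PlaneData.mixedRow q (a 0) (a 2)).withTransportedTorus g g' hgg' hg'g hgΩ)) :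
    ‖cutFactor q a g g' hgg' hg'g hgΩ lam hiso eP' eM' R w' x‖ ≤ (R + 1) ^ coeffDegree (eP' w') (eM' w') := by
  unfold cutFactor
  by_cases hc : cutoff q a g g' hgg' hg'g hgΩ lam hiso w' R x = 0
  · rw [hc, mul_zero, norm_zero]
    positivity
  · have hlt := locSize_lt_of_cutoff_ne_zero q a g g' hgg' hg'g hgΩ lam hiso w' R hc
    have h00 : ‖locEntry' q a g g' hgg' hg'g hgΩ lam hiso w' x 0 0‖ ≤ R + 1 :=
      (norm_locEntry'_le_locSize q a g g' hgg' hg'g hgΩ lam hiso w' x 0 0).trans hlt.le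
    have h11 : ‖locEntry' q a g g' hgg' hg'g hgΩ lam hiso w' x 1 1‖ ≤ R + 1 :=
      (norm_locEntry'_le_locSize q a g g' hgg' hg'g hgΩ lam hiso w' x 1 1).trans hlt.le
    rw [norm_mul]
    calc ‖defCoeff q a g g' hgg' hg'g hgΩ lam hiso w' (eP' w') (eM' w') x‖ *
          ‖cutoff q a g g' hgg' hg'g hgΩ lam hiso w' R x‖
        ≤ ‖defCoeff q a g g' hgg' hg'g hgΩ lam hiso w' (eP' w') (eM' w') x‖ * 1 :=
          mul_le_mul_of_nonneg_left (norm_cutoff_le_one q a g g' hgg' hg'g hgΩ lam hiso w' R x) (norm_nonneg _)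
      _ = ‖defCoeff q a g g' hgg' hg'g hgΩ lam hiso w' (eP' w') (eM' w') x‖ := mul_one _
      _ ≤ (R + 1) ^ coeffDegree (eP' w') (eM' w') :=
          norm_defCoeff_le_pow q a g g' hgg' hg'g hgΩ lam hiso w' _ _ (by linarith) x h00 h11

/-- the support law: `cutFactor w′ x ≠ 0 → locSize w′ x < R + 1`. -/
theorem locSize_lt_of_cutFactor_ne_zero (w' : InfinitePlace k)
    {x : GA ((PlaneData.mixedRow q (a 0) (a 2)).withTransportedTorus g g' hgg' hg'g hgΩ)}
    (h : cutFactor q a g g' hgg' hg'g hgΩ lam hiso eP' eM' R w' x ≠ 0) :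
    locSize q a g g' hgg' hg'g hgΩ lam hiso w' x < R + 1 :=
  locSize_lt_of_cutoff_ne_zero q a g g' hgg' hg'g hgΩ lam hiso w' R (right_ne_zero_of_mul h)

end Factor

end Summit.Ventures.HodgeRepro.Tier4.Line4

end
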